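/-
Copyright: statement-level skeleton of a published paper (lit-balaban cell, Phase-2 proof seat p26 gen 28). No claims beyond
what the kernel checks below.
-/
import Mathlib
import Literature.MathematicalPhysics.QuantumFieldTheory.Balaban1983to89.B3TwoVertexBlocks
import Literature.MathematicalPhysics.QuantumFieldTheory.Balaban1983to89.B3Prop22FreeLinesExample
import Literature.MathematicalPhysics.QuantumFieldTheory.Balaban1983to89.B3Sect3LowestOrderGraphs

/-!
# B3 — T. Bałaban, *(Higgs)₂,₃ quantum fields in a finite volume. III. Renormalization*, CMP **88** (1983) 411–445
[Balaban1983Higgs3] — pp. 435–436 [PDF 25–26]: the lowest-order scalar self-energy graph **(3.6)₁ = (3.8)** (with its mass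
counterterm (3.7)₁) and its generalized graph **(3.12)** as WORKED MEMBERS of the family of generalized graphs of Proposition 2.2
(seat p18 gen 7's `famK`)

statement-level skeleton of published theorems with citation tags; proofs where landed; nothing here is a claim about
the Yang–Mills mass gap

PDF held: `paper:balaban1983-higgs-2-3-quantum-fields-finite-volume` (journal page = PDF page + 410); pp. 417, 423–424, 435–436
[PDF 7, 13–14, 25–26] read in the OCR text (`p0025.txt`) and on the ×2 renders
`run/shared/lean/pub/pub-balaban/b2b-balaban-ref1/pages/1983-cmp88-higgs23-III/1983-cmp88-higgs23-III-p007,p013,p025,p026-x2.png`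
(the pictures (3.6)–(3.8), (3.12), the counterterm convention of p. 417, the degrees (2.2) p. 423 and the graph (2.4) p. 424).

CITATION HEADER (lean-in-tree rule).  lit-balaban TYPED SKELETON (HOME `run/shared/lean/pub/lit-balaban/`), PHASE 2, seat p26
gen 28, file 1 of 2 (file 2 `B3Eq330Members`: the vector graphs (3.25)/(3.30) and the pictures as expressions); free target
`lit-balaban-r15/B3-CLOSURE.md` v1.1 §5 item 3 (*"the (3.30)–(3.32) and (3.7)/(3.8) pictures as drawn objects"*), in the format of
p18 gen 8's `B3Eq322Member` / p19 gen 7's `B3Eq318Members`.  ROWS **B3.Eq3.6-3.9** (pictures (3.6)₁/(3.7)₁/(3.8)), **B3.Eq3.11-3.17**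
((3.12)), **B3.Prop2.2** (worked members) of `HOME/lit-balaban-r15/ROWS-B3.md` (fold owner r15, referee ref-4).  CONSUMES BY NAME:
p19's `Counts`/two-vertex block calculus (`B3TwoVertexBlocks`), p18 gen 7's family (`CGraphK`, `DatumK`, `expansionK`, `famK`,
`degQK`, `Is24K`, `prop21_freeLines`) at `B3Prop22FreeLinesExample.paramsK24` (`d = 3`, `L = 2`, `δ₁ = 1`, menu `{0, 3/2}`,
`3/2 = 1 + α`: *"e.g. if we take α₀ = ½"* p. 421), p18 gen 3's reading `B3Sect3LowestOrderGraphs.g36a` and its degree `g36a_deg`.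

THE PRINTED TEXT (verbatim).  p. 435 [PDF 25]: *"Let us start with self-energy graphs for scalar fields. The graphs of lowest order
are [three pictures] (D = −d + 2), (3.6) and the renormalized class G_ren contains the corresponding mass renormalization
counterterms also: (−1)·[picture], (−1)·[picture], (−1)·[picture] (3.7) … We will consider in detail an expression corresponding
to [picture − picture] (3.8) The method described below, and even a simplified one, will be applied to all other primitively
divergent graphs (graphs whose every proper subgraph is convergent)."*; p. 417 [PDF 7]: *"If a graph G representing Σ^ε_G(x − x′)
has the external legs localized in x, x′, then δm²_G = Σ_{x′∈T_ε} ε^dΣ^ε_G(x − x′) will be represented by the same graph G but with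
both external legs localized in x and with the summation over x′."*; p. 423 [PDF 13]: *"If we have a counterterm from δm²_k,
then it corresponds to some graph G₀ and we define a degree of this counterterm as the degree of the graph G₀."*; p. 436 [PDF 26]:
*"The second expression above already has the right form because the factor |x − x|^{1+α}* ⟦sic; the print misprints
`|x − x|` for `|x′ − x|`, cf. (3.10)/(3.11)⟧ *adds to the degree of the graph the number 1 + α, thus the degree of the
expression is equal to −d + 3 + α now. The operator acting on the leg φ′ is a
differentiation of the order 1 + α, so we will represent graphically this expression by the generalized graph [the graph (3.8)
with +(1+α) on the loop and −(1+α) at the differentiated external leg] (3.12)"*.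

WHAT IS TYPED / PROVED (count data at `d = 3`, `L = 2`, `δ₁ = 1`, vertices `x = 0`, `x′ = 1`, both lines `x → x′`; η-power
of (1.8)_{1,0} = `0`; every line has dimension `−½` per leg and `−1` per differentiation acting on it, (2.14); external legs and
the `−(1+α)` derivative on the external leg of (3.12) live in the amplitude's vertex functions, as in every member of p18/p19).
§1 `bubble δ`: the generic two-vertex datum with differentiation pattern `δ` (also the datum of (3.21)₂ = p18's `graph322` and of
(3.25)₁,₂, file 2), its block calculus along both orderings in closed form (`block_cases`: the non-trivial blocks are `G′₁`, `G′₂`;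
`lineDimQ_bubble`; `degQ_one/two`, `degQK_one/two`) and the exponent vector `κ312 = (3/2, 0)` (`+(1+α)` on the line `0`).
§2 **(3.6)₁ = the graph of (3.8)** as `graph38` (line `0` = the φ′-line through BOTH differentiated legs, `a₀ = −3` — the kernel
`(∂^η_μG_{(j)}(0)∂^{η*}_μ)(x,x′)` of (3.9); line `1` = the A′-line, `a₁ = −1`); the counterterm picture (3.7)₁ is by p. 417 the same
graph with both legs localized in `x` — the same count datum, of the same degree (p. 423).  `W = −1 = −d + 2` = p18's
`g36a_deg 3` (`wholeDeg_graph38_eq_deg`); the φ′-line block `G′₁` IS THE GRAPH (2.4), `D = 0` (`degQ_one_graph38`,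
`is24Block_graph38`) — (3.8) is not primitively divergent, whence its detailed treatment (3.9)–(3.17); with NO extra dimension the
member FAILS the printed hypothesis of Propositions 2.1/2.2 (`not_posSubgraphsExcept24_memberK38`: `D(G′) = −1`, two lines) — it
is divergent and carries the counterterm (3.7)₁.  **The generalized graph (3.12)** `memberK312` has EVERY block positive,
`D_K(G′₁) ∈ {3/2, 2}`, **`D_K(G′) = −1 + 3/2 = ½ = −d + 3 + α`** (`degQK_two_graph38_shift`, the printed degree), so r15's PRINTED
hypothesis holds through positivity along both orderings (`posSubgraphsExcept24_memberK312`, `not_is24_memberK312`) and **(1.33)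
holds for it** by `prop21_freeLines` (`ineq133_memberK312`).
HONEST SCOPE: members of the ABSTRACT-amplitude family `famK` (amplitudes = any `IBPAmpK` datum within the class budgets; the `+(1+α)`
line is the weighted kernel `K(x,x′)|x−x′|^{1+α}`, cf. the weight lemmas `B3Eq322PositiveDegree.exp_mul_rpow_le`,
`B3Ineq313Pointwise.mul_rpow_mul_exp_le_scale`; the genuine-kernel family `famZK` has `κ ≤ 0` lines only); `d = 3` only; which
`x–x′` line carries `+(1+α)` is immaterial for positivity (here the φ′-line).  D-0026: definitions with bodies (one generic datum,
one pattern, one exponent vector, two members) + theorems; no named facts, no `sorry`; standard axioms.  Unit `lit-balaban-p26`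
gen 28 (literature-prover-lit-balaban-p26-g28-0), HOME `run/shared/lean/pub/lit-balaban/`, 2026-08-22.
v1.1 (p26 gen 34, 2026-08-23; DOC-ONLY, declarations byte-identical): referee ref-1 g74 F1 docfix — the p. 436 sentence is now quoted
AS PRINTED, «|x − x|^{1+α}», with a ⟦sic⟧ note (the print misprints `|x − x|` for `|x′ − x|`; v1.0 had silently corrected it inside
the verbatim marks), in the module docstring and in the docstring of `degQK_two_graph38_shift`.
-/

open Finset

namespace Literature.MathematicalPhysics.QuantumFieldTheory.Balaban1983to89.B3Eq312Member

/-! ## §1 The generic two-vertex datum with two lines `x → x′` -/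

section Members

open B3Ineq215 B3Ineq213 B3Sect2FirstEstimate B3Prop1 B3FreeLine B3TwoVertexBlocks

/-- **The two-vertex, two-line pictures of Sect. 3** ((3.6)₁ = (3.8), (3.21)₂, (3.25)₁,₂) as p19 count data: vertices `x = 0`,
`x′ = 1` of type (1.8)_{1,0} (η-power `0`), two lines `x → x′` (line `l` of (2.14)-dimension `−1 − δ_x(l) − δ_{x′}(l)`), the
pattern `δ v l` = the number of differentiations of the vertex `v` acting on the line `l`; no averaged vector legs; `d = 3`,
`L = 2`, `δ₁ = 1`. [cite: Balaban1983Higgs3, (2.14) p.427] -/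
noncomputable def bubble (δ : Fin 2 → Fin 2 → ℕ) : Counts (Fin 2) 2 where
  src := fun _ => 0
  tgt := fun _ => 1
  touches := fun v => ⟨0, by fin_cases v <;> simp⟩
  diffOn := δ
  vecLegAvg := fun _ _ => 0
  etaPow := fun _ => 0
  d := 3
  L := 2
  δ₁ := 1
  d_pos := by norm_num
  two_le_L := le_rfl
  δ₁_pos := one_pos

variable (δ : Fin 2 → Fin 2 → ℕ)

/-- Both lines join `x` to `x′`. [cite: Balaban1983Higgs3, (2.16) p.428] -/
theorem orient_bubble : ∀ l, (bubble δ).src l ≠ (bubble δ).tgt l → (bubble δ).src l = 0 := fun _ _ => rfl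

/-- The datum is connected. [cite: Balaban1983Higgs3, Prop. 2.1 p.424] -/
theorem linesConnect_bubble : LinesConnect (bubble δ).src (bubble δ).tgt :=
  linesConnect_twoVertex (bubble δ) ⟨0, rfl, rfl⟩

/-- **(2.14)**: `a_l = −½ − ½ − δ_x(l) − δ_{x′}(l)` (two legs of dimension `−½`, `−1` per differentiation on the line). [cite: Balaban1983Higgs3, (2.14) p.427] -/
theorem lineDimQ_bubble (l : Fin 2) : lineDimQ (bubble δ) l = -1 - ((δ 0 l : ℚ) + δ 1 l) := by
  have h0 : (bubble δ).legsOn 0 l = 1 := by unfold Counts.legsOn; simp [bubble]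
  have h1 : (bubble δ).legsOn 1 l = 1 := by unfold Counts.legsOn; simp [bubble]
  have hd : (bubble δ).d = 3 := rfl
  have hv : ∀ v, (bubble δ).vecLegAvg v l = 0 := fun _ => rfl
  have hδ : ∀ v, (bubble δ).diffOn v l = δ v l := fun _ => rfl
  unfold lineDimQ legExpQ
  rw [Fin.sum_univ_two, h0, h1, hd, hv, hv, hδ, hδ]
  push_cast
  ring

/-- Every line has two different endpoints, along any ordering. [cite: Balaban1983Higgs3, (2.16) p.428] -/
theorem src_ne_tgt (σ : Equiv.Perm (Fin 2)) (l : Fin 2) :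
    (relabelCounts (bubble δ) σ).src l ≠ (relabelCounts (bubble δ) σ).tgt l := by
  change (0 : Fin 2) ≠ 1
  decide

/-- For `i ≥ 1` the first line of the ordering has been shrunk: the witness used by p19's closed forms. [cite: Balaban1983Higgs3, (2.16) p.428] -/
theorem conn_wit (σ : Equiv.Perm (Fin 2)) {i : ℕ} (hi : 1 ≤ i) :
    ∃ l : Fin 2, (l : ℕ) < i ∧ (relabelCounts (bubble δ) σ).src l ≠ (relabelCounts (bubble δ) σ).tgt l :=
  ⟨0, by change 0 < i; omega, src_ne_tgt δ σ 0⟩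

/-- The non-trivial blocks along an ordering `σ` of the two lines are those of `G′₁`, `G′₂` (index `i ∈ {1, 2}` in `Fin 3`), all
represented by `x = 0` (no block of `G′₀` is non-trivial; the first line shrunk joins `x` to `x′`). [cite: Balaban1983Higgs3, (2.16) p.428] -/
theorem block_cases {σ : Equiv.Perm (Fin 2)} {i : Fin 3} {b : Fin 2}
    (hb : b ∈ (relabelCounts (bubble δ) σ).toModel.reps (i : ℕ))
    (hn : (relabelCounts (bubble δ) σ).toModel.Nontriv (i : ℕ) b) : ((i : ℕ) = 1 ∨ (i : ℕ) = 2) ∧ b = 0 := by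
  have hi : 1 ≤ (i : ℕ) := by
    by_contra h0
    rw [show (i : ℕ) = 0 by omega] at hn
    exact not_nontriv_zero _ b hn
  exact ⟨by have := i.isLt; omega, eq_zero_of_mem_reps_of_conn (relabelCounts (bubble δ) σ)
    (orient_relabelCounts (bubble δ) (orient_bubble δ) σ) (conn_wit δ σ hi) hb⟩

/-- **(2.2) in closed form for the blocks `G′_i`, `i ≥ 1`**: both vertices and the first `i` lines of the ordering,
`D(G′_i) = (3 + 0) + (3 + 0) − 3 + Σ_{l<i} a_{σl}`. [cite: Balaban1983Higgs3, (2.2) p.423] -/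
theorem degQ_block (σ : Equiv.Perm (Fin 2)) {i : ℕ} (hi : 1 ≤ i) :
    degQ (relabelCounts (bubble δ) σ) i 0 =
      3 + ∑ l ∈ univ.filter (fun l : Fin 2 => (l : ℕ) < i), lineDimQ (bubble δ) (σ l) := by
  rw [degQ_of_conn (relabelCounts (bubble δ) σ) (orient_relabelCounts (bubble δ) (orient_bubble δ) σ) (conn_wit δ σ hi)]
  simp only [lineDimQ_relabelCounts]
  have hd : (relabelCounts (bubble δ) σ).d = 3 := rfl
  have he : ∀ v, (relabelCounts (bubble δ) σ).etaPow v = 0 := fun _ => rfl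
  rw [hd, he, he]
  push_cast
  ring

/-- The generalized degree of the same blocks: `D_K(G′_i) = D(G′_i) + Σ_{l<i} κ_{σl}`. [cite: Balaban1983Higgs3, (2.2) p.423] -/
theorem degQK_block (κ : Fin 2 → ℚ) (σ : Equiv.Perm (Fin 2)) {i : ℕ} (hi : 1 ≤ i) :
    degQK (relabelCounts (bubble δ) σ) (κ ∘ σ) i 0 =
      3 + ∑ l ∈ univ.filter (fun l : Fin 2 => (l : ℕ) < i), (lineDimQ (bubble δ) (σ l) + κ (σ l)) := by
  unfold degQK
  rw [degQ_block δ σ hi,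
    before_of_conn (relabelCounts (bubble δ) σ) (orient_relabelCounts (bubble δ) (orient_bubble δ) σ) (conn_wit δ σ hi),
    sum_add_distrib]
  simp only [Function.comp_apply]
  ring

/-- The first line of an ordering of two lines is the position `0`. [folklore] -/
private theorem filter_lt_one : (univ.filter fun l : Fin 2 => (l : ℕ) < 1) = {0} := by decide

/-- The first two lines of an ordering of two lines are both positions. [folklore] -/
private theorem filter_lt_two : (univ.filter fun l : Fin 2 => (l : ℕ) < 2) = univ := by decide

/-- `D(G′₁) = 3 + a_{σ0}`. [cite: Balaban1983Higgs3, (2.2) p.423] -/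
theorem degQ_one (σ : Equiv.Perm (Fin 2)) :
    degQ (relabelCounts (bubble δ) σ) 1 0 = 3 + lineDimQ (bubble δ) (σ 0) := by
  rw [degQ_block δ σ le_rfl, filter_lt_one, sum_singleton]

/-- `D(G′₂) = D(G′) = 3 + a₀ + a₁`, whatever the ordering. [cite: Balaban1983Higgs3, (2.2) p.423] -/
theorem degQ_two (σ : Equiv.Perm (Fin 2)) :
    degQ (relabelCounts (bubble δ) σ) 2 0 = 3 + (lineDimQ (bubble δ) 0 + lineDimQ (bubble δ) 1) := by
  rw [degQ_block δ σ one_le_two, filter_lt_two,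
    Fintype.sum_equiv σ (fun l => lineDimQ (bubble δ) (σ l)) (lineDimQ (bubble δ)) (fun _ => rfl), Fin.sum_univ_two]

/-- `D_K(G′₁) = 3 + a_{σ0} + κ_{σ0}`. [cite: Balaban1983Higgs3, (3.12) p.436] -/
theorem degQK_one (κ : Fin 2 → ℚ) (σ : Equiv.Perm (Fin 2)) :
    degQK (relabelCounts (bubble δ) σ) (κ ∘ σ) 1 0 = 3 + (lineDimQ (bubble δ) (σ 0) + κ (σ 0)) := by
  rw [degQK_block δ κ σ le_rfl, filter_lt_one, sum_singleton]

/-- `D_K(G′₂) = D_K(G′) = 3 + a₀ + a₁ + κ₀ + κ₁`, whatever the ordering. [cite: Balaban1983Higgs3, (3.12) p.436] -/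
theorem degQK_two (κ : Fin 2 → ℚ) (σ : Equiv.Perm (Fin 2)) :
    degQK (relabelCounts (bubble δ) σ) (κ ∘ σ) 2 0 =
      3 + ((lineDimQ (bubble δ) 0 + κ 0) + (lineDimQ (bubble δ) 1 + κ 1)) := by
  rw [degQK_block δ κ σ one_le_two, filter_lt_two,
    Fintype.sum_equiv σ (fun l => lineDimQ (bubble δ) (σ l) + κ (σ l)) (fun l => lineDimQ (bubble δ) l + κ l) (fun _ => rfl),
    Fin.sum_univ_two]

/-- kernel: an element of `Fin 2` is `0` or `1`. [folklore] -/
private theorem fin_two_eq (i : Fin 2) : i = 0 ∨ i = 1 := by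
  fin_cases i <;> simp

/-- The extra line dimensions of the generalized graphs (3.12)/(3.30): `+(1 + α) = 3/2` (`α = ½`) on the line `0` (the weight
`|x − x′|^{1+α}` of the Taylor remainder multiplies the product of both propagators, (3.11)/(3.26)), `0` on the line `1`. [cite: Balaban1983Higgs3, (3.12) p.436] -/
def κ312 : Fin 2 → ℚ := fun l => if l = 0 then 3 / 2 else 0

/-- Both exponents are on the menu `{0, 3/2}` of `paramsK24`. [cite: Balaban1983Higgs3, Prop. 2.2 p.428] -/
theorem κ312_mem_menu (Cmax CD : ℝ) (l : Fin 2) : κ312 l ∈ (paramsK24 Cmax CD).menu := by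
  unfold κ312
  split_ifs
  · exact shift_mem_menu24 Cmax CD
  · exact zero_mem_menu24 Cmax CD

/-- **A two-vertex picture `bubble δ` with menu-valued extra line dimensions `κ` as a member of the family of Proposition 2.2**
(p18 gen 7's `famK` at the constants `paramsK24`: `d = 3`, `L = 2`, `δ₁ = 1`, menu `{0, 3/2}`), at every size bound `mb ≥ 2`.
[cite: Balaban1983Higgs3, Prop. 2.2 p.428] -/
noncomputable def memberOf (κ : Fin 2 → ℚ) (Cmax CD : ℝ) (hκ : ∀ l, κ l ∈ (paramsK24 Cmax CD).menu) {mb : ℕ} (h : 2 ≤ mb) :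
    CGraphK (paramsK24 Cmax CD) mb where
  n := 2
  m := 2
  m_le := h
  G := bubble δ
  d_eq := rfl
  L_eq := rfl
  δ₁_eq := rfl
  conn := linesConnect_bubble δ
  κ := κ
  κ_mem := hκ

/-! ## §2 The graph (3.6)₁ = (3.8) and its generalized graph (3.12) -/

/-- The differentiation pattern of (3.6)₁/(3.8): both vertices differentiate the line `0` (the φ′-line joins the two
differentiated legs: the kernel `(∂^η_μG_{(j)}(0)∂^{η*}_μ)(x,x′)` of (3.9)); the A′-line `1` is plain. [cite: Balaban1983Higgs3, (3.8) p.435] -/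
def δ38 : Fin 2 → Fin 2 → ℕ := fun _ l => if l = 0 then 1 else 0

/-- **The graph (3.6)₁ = (3.8)** p. 435 [PDF 25] as a count datum (p18's reading `B3Sect3LowestOrderGraphs.g36a`: two vertices
(1.8)_{1,0}, the φ′-line through both differentiated legs, the A′-line; one φ′-leg of each vertex external).  The mass
counterterm picture (3.7)₁ is, by the convention of p. 417, *"the same graph G but with both external legs localized in x"* —
the same count datum, the localization living in the amplitude (file 2, `expr39_eq_neg_subtracted319`).
[cite: Balaban1983Higgs3, (3.6) p.435] -/
noncomputable def graph38 : Counts (Fin 2) 2 := bubble δ38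

/-- **(2.14)** for (3.8): `a₀ = −1 − 2 = −3` (φ′-line, differentiated at both ends), `a₁ = −1` (A′-line).
[cite: Balaban1983Higgs3, (2.14) p.427] -/
theorem lineDimQ_graph38 (l : Fin 2) : lineDimQ graph38 l = if l = 0 then -3 else -1 := by
  rw [graph38, lineDimQ_bubble]
  rcases fin_two_eq l with h | h <;> subst h <;> norm_num [δ38]

/-- **(3.6) "(D = −d + 2)"**, first picture, on the count datum: `W = 3 + 0 + 0 − 3 − 1 = −1`. [cite: Balaban1983Higgs3, (3.6) p.435] -/
theorem wholeDeg_graph38 : (graph38.d : ℚ) + graph38.etaPow 0 + graph38.etaPow 1 + ∑ l, lineDimQ graph38 l = -1 := by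
  have hd : graph38.d = 3 := rfl
  have he : ∀ v, graph38.etaPow v = 0 := fun _ => rfl
  rw [Fin.sum_univ_two, lineDimQ_graph38, lineDimQ_graph38, hd, he, he]
  norm_num

/-- The two degree counts of the tree agree: `W` = p18 gen 3's catalogue degree `2 − d` of (3.6)₁ at `d = 3`. [cite: Balaban1983Higgs3, (3.6) p.435] -/
theorem wholeDeg_graph38_eq_deg (nbar : ℕ) (hn : 1 ≤ nbar) :
    (graph38.d : ℚ) + graph38.etaPow 0 + graph38.etaPow 1 + ∑ l, lineDimQ graph38 l =
      (B3Sect3LowestOrderGraphs.g36a nbar hn).deg 3 := by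
  rw [wholeDeg_graph38, B3Sect3LowestOrderGraphs.g36a_deg]; norm_num

/-- **The subgraph (2.4) inside (3.8)**: shrinking the φ′-line first, `G′₁` = both vertices joined by the doubly differentiated
scalar line = the graph (2.4) p. 424, degree `3 − 3 = 0`; shrinking the A′-line first, `D(G′₁) = 3 − 1 = 2`.  So (3.8) is NOT
*"primitively divergent"* (p. 435) — it is the graph treated *"in detail"* by (3.9)–(3.17). [cite: Balaban1983Higgs3, (2.4) p.424] -/
theorem degQ_one_graph38 (σ : Equiv.Perm (Fin 2)) :
    degQ (relabelCounts graph38 σ) 1 0 = if σ 0 = 0 then 0 else 2 := by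
  rw [graph38, degQ_one δ38 σ, ← graph38, lineDimQ_graph38]
  split_ifs <;> norm_num

/-- That degree-`0` block IS a (2.4)-block in p19's sense (one line with two endpoints carrying a differentiation of its first
endpoint, degree `0`). [cite: Balaban1983Higgs3, (2.4) p.424] -/
theorem is24Block_graph38 (σ : Equiv.Perm (Fin 2)) (h : σ 0 = 0) : Is24Block (relabelCounts graph38 σ) 1 0 := by
  refine ⟨by rw [degQ_one_graph38, if_pos h], 0, src_ne_tgt δ38 σ 0, ?_, ?_⟩
  · show 1 ≤ δ38 0 (σ 0)
    rw [h]; decide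
  · rw [before_of_conn (relabelCounts graph38 σ) (orient_relabelCounts graph38 (orient_bubble δ38) σ)
      (conn_wit δ38 σ le_rfl), filter_lt_one]

/-- **"(D = −d + 2)"**: the whole graph (3.8) has degree `−1` along either ordering. [cite: Balaban1983Higgs3, (3.6) p.435] -/
theorem degQ_two_graph38 (σ : Equiv.Perm (Fin 2)) : degQ (relabelCounts graph38 σ) 2 0 = -1 := by
  rw [graph38, degQ_two δ38 σ, ← graph38, lineDimQ_graph38, lineDimQ_graph38]
  norm_num

/-- **(3.8) with NO extra dimension** (`κ ≡ 0`) as a member of the family of Proposition 2.2. [cite: Balaban1983Higgs3, Prop. 2.2 p.428] -/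
noncomputable abbrev memberK38 (Cmax CD : ℝ) {mb : ℕ} (h : 2 ≤ mb) : CGraphK (paramsK24 Cmax CD) mb :=
  memberOf δ38 (fun _ => 0) Cmax CD (fun _ => zero_mem_menu24 Cmax CD) h

/-- **(3.8) ITSELF IS DIVERGENT — the printed hypothesis of Propositions 2.1/2.2 FAILS for it**: the whole graph `G′₂` has degree
`−1 < 0` and two lines (neither positive nor the exception (2.4)); hence the counterterm (3.7)₁ and (3.9)–(3.17). [cite: Balaban1983Higgs3, (3.8) p.435] -/
theorem not_posSubgraphsExcept24_memberK38 (Cmax CD : ℝ) {mb : ℕ} (h : 2 ≤ mb) (D : DatumK (paramsK24 Cmax CD)) :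
    ¬ PosSubgraphsExcept24 (expansionK (paramsK24 Cmax CD) mb D) (memberK38 Cmax CD h) := by
  rintro ⟨-, hall⟩
  have hall' : ∀ H : Component graph38,
      Is24K (relabelCounts graph38 H.1) ((fun _ : Fin 2 => (0 : ℚ)) ∘ H.1) H.2.1 H.2.2.1 ∨
        0 < degQK (relabelCounts graph38 H.1) ((fun _ : Fin 2 => (0 : ℚ)) ∘ H.1) H.2.1 H.2.2.1 := hall
  have hb : (0 : Fin 2) ∈ (relabelCounts graph38 1).toModel.reps 2 := by
    rw [reps_of_conn (relabelCounts graph38 1) (orient_relabelCounts graph38 (orient_bubble δ38) 1)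
      (conn_wit δ38 1 one_le_two)]
    exact mem_singleton_self _
  have hn : (relabelCounts graph38 1).toModel.Nontriv 2 0 := by
    refine ⟨0, ?_⟩
    rw [before_of_conn (relabelCounts graph38 1) (orient_relabelCounts graph38 (orient_bubble δ38) 1)
      (conn_wit δ38 1 one_le_two), filter_lt_two]
    exact mem_univ _
  have h' : Is24K (relabelCounts graph38 1) ((fun _ : Fin 2 => (0 : ℚ)) ∘ ⇑(1 : Equiv.Perm (Fin 2))) 2 0 ∨
      0 < degQK (relabelCounts graph38 1) ((fun _ : Fin 2 => (0 : ℚ)) ∘ ⇑(1 : Equiv.Perm (Fin 2))) 2 0 :=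
    hall' ⟨1, ⟨2, by norm_num⟩, ⟨0, hb, hn⟩⟩
  rcases h' with ⟨⟨hdeg, -⟩, -⟩ | hpos
  · rw [degQ_two_graph38] at hdeg
    norm_num at hdeg
  · have hval : degQK (relabelCounts graph38 1) ((fun _ : Fin 2 => (0 : ℚ)) ∘ ⇑(1 : Equiv.Perm (Fin 2))) 2 0 = -1 := by
      rw [graph38, degQK_two δ38 (fun _ => (0 : ℚ)) 1, ← graph38, lineDimQ_graph38, lineDimQ_graph38]
      norm_num
    rw [hval] at hpos
    norm_num at hpos

/-- **The generalized graph (3.12) is a member of the family of Proposition 2.2**: the graph (3.8) with `+(1+α) = 3/2` on its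
loop (`κ312`), at every size bound `mb ≥ 2`. [cite: Balaban1983Higgs3, (3.12) p.436] -/
noncomputable abbrev memberK312 (Cmax CD : ℝ) {mb : ℕ} (h : 2 ≤ mb) : CGraphK (paramsK24 Cmax CD) mb :=
  memberOf δ38 κ312 Cmax CD (κ312_mem_menu Cmax CD) h

/-- **The proper blocks of (3.12)**: `D_K(G′₁) = 0 + 3/2` if the φ′-line (dimension `−3 + (1+α)`) is shrunk first, `2` if the
A′-line is — positive either way. [cite: Balaban1983Higgs3, (3.12) p.436] -/
theorem degQK_one_graph38_shift (σ : Equiv.Perm (Fin 2)) :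
    degQK (relabelCounts graph38 σ) (κ312 ∘ σ) 1 0 = if σ 0 = 0 then 3 / 2 else 2 := by
  rw [graph38, degQK_one δ38 κ312 σ, ← graph38, lineDimQ_graph38]
  unfold κ312
  split_ifs <;> norm_num

/-- **p. 436 "the factor |x − x|^{1+α}** ⟦sic; `|x′ − x|` is meant⟧ **adds to the degree of the graph the number 1 + α, thus the degree
of the expression is equal to −d + 3 + α now"**: `D_K(G′) = −1 + 3/2 = ½ = −3 + 3 + ½`, along either ordering. [cite: Balaban1983Higgs3, (3.12) p.436] -/
theorem degQK_two_graph38_shift (σ : Equiv.Perm (Fin 2)) : degQK (relabelCounts graph38 σ) (κ312 ∘ σ) 2 0 = 1 / 2 := by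
  rw [graph38, degQK_two δ38 κ312 σ, ← graph38, lineDimQ_graph38, lineDimQ_graph38]
  norm_num [κ312]

/-- Every non-trivial block of (3.12) along every ordering has POSITIVE generalized degree (`3/2`, `2` or `½`).
[cite: Balaban1983Higgs3, (3.12) p.436] -/
theorem degQK_block_pos_graph38 {σ : Equiv.Perm (Fin 2)} {i : Fin 3} {b : Fin 2}
    (hb : b ∈ (relabelCounts graph38 σ).toModel.reps (i : ℕ)) (hn : (relabelCounts graph38 σ).toModel.Nontriv (i : ℕ) b) :
    0 < degQK (relabelCounts graph38 σ) (κ312 ∘ σ) i b := by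
  obtain ⟨hi, rfl⟩ := block_cases δ38 hb hn
  rcases hi with hi | hi
  · rw [hi, degQK_one_graph38_shift]
    split_ifs <;> norm_num
  · rw [hi, degQK_two_graph38_shift]
    norm_num

/-- No block of (3.12) is an exceptional (2.4)-block of the generalized graph: `G′₁` has `D ≠ 0` or carries the extra dimension
`3/2 ≠ 0` on its line, `G′₂` has two lines. [cite: Balaban1983Higgs3, (2.4) p.424] -/
theorem not_is24K_block_graph38 {σ : Equiv.Perm (Fin 2)} {i : Fin 3} {b : Fin 2}
    (hb : b ∈ (relabelCounts graph38 σ).toModel.reps (i : ℕ)) (hn : (relabelCounts graph38 σ).toModel.Nontriv (i : ℕ) b) :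
    ¬ Is24K (relabelCounts graph38 σ) (κ312 ∘ σ) i b := by
  obtain ⟨hi, rfl⟩ := block_cases δ38 hb hn
  have hbefore : ∀ {j : ℕ}, 1 ≤ j → (relabelCounts graph38 σ).toModel.before j 0 =
      univ.filter (fun l : Fin 2 => (l : ℕ) < j) := fun hj =>
    before_of_conn (relabelCounts graph38 σ) (orient_relabelCounts graph38 (orient_bubble δ38) σ) (conn_wit δ38 σ hj)
  rintro ⟨⟨hdeg, l, -, -, hbl⟩, hκ⟩
  rcases hi with hi | hi
  · rw [hi] at hdeg hκ
    rw [degQ_one_graph38] at hdeg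
    split_ifs at hdeg with h0
    · have := hκ 0 (by rw [hbefore le_rfl, filter_lt_one]; exact mem_singleton_self _)
      simp [κ312, h0] at this
    · norm_num at hdeg
  · rw [hi, hbefore one_le_two, filter_lt_two] at hbl
    have h0 : (0 : Fin 2) ∈ ({l} : Finset (Fin 2)) := by rw [← hbl]; exact mem_univ _
    have h1 : (1 : Fin 2) ∈ ({l} : Finset (Fin 2)) := by rw [← hbl]; exact mem_univ _
    rw [mem_singleton] at h0 h1
    exact absurd (h0.trans h1.symm) (by decide)

/-- **The PRINTED hypothesis of Propositions 2.1/2.2 HOLDS for the generalized graph (3.12), through positivity, along both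
orderings** — p. 436: the subtracted expression *"already has the right form"*. [cite: Balaban1983Higgs3, Prop. 2.2 p.428] -/
theorem posSubgraphsExcept24_memberK312 (Cmax CD : ℝ) {mb : ℕ} (h : 2 ≤ mb) (D : DatumK (paramsK24 Cmax CD)) :
    PosSubgraphsExcept24 (expansionK (paramsK24 Cmax CD) mb D) (memberK312 Cmax CD h) := by
  refine ⟨trivial, ?_⟩
  show ∀ H : Component graph38,
    Is24K (relabelCounts graph38 H.1) (κ312 ∘ H.1) H.2.1 H.2.2.1 ∨ 0 < degQK (relabelCounts graph38 H.1) (κ312 ∘ H.1) H.2.1 H.2.2.1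
  rintro ⟨σ, i, b, hb, hn⟩
  exact Or.inr (degQK_block_pos_graph38 hb hn)

/-- … and none through the exception (2.4). [cite: Balaban1983Higgs3, (2.4) p.424] -/
theorem not_is24_memberK312 (Cmax CD : ℝ) {mb : ℕ} (h : 2 ≤ mb) (D : DatumK (paramsK24 Cmax CD)) :
    ∀ H : (expansionK (paramsK24 Cmax CD) mb D).Sub (memberK312 Cmax CD h),
      ¬ (expansionK (paramsK24 Cmax CD) mb D).Is24 (memberK312 Cmax CD h) H := by
  show ∀ H : Component graph38, ¬ Is24K (relabelCounts graph38 H.1) (κ312 ∘ H.1) H.2.1 H.2.2.1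
  rintro ⟨σ, i, b, hb, hn⟩
  exact not_is24K_block_graph38 hb hn

/-- **(1.33) for the generalized graph (3.12)**, as asserted by `prop21_freeLines` (the constant `O(1)(n̄)` of the family at a size
bound `m̄(n̄) ≥ 2`): for every datum, every localization and all external-field data — *"Proposition 2.2 can be applied"*.
[cite: Balaban1983Higgs3, Prop. 2.2 p.428] -/
theorem ineq133_memberK312 (Cmax CD : ℝ) (mbar : ℕ → ℕ) (nbar : ℕ) (h : 2 ≤ mbar nbar) (α₀ : ℝ) (h0 : 0 < α₀)
    (h1 : α₀ < 1) :
    ∃ δ₀ C : ℝ, 0 < δ₀ ∧ 0 < C ∧ ∀ D : DatumK (paramsK24 Cmax CD),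
      Ineq133At (famK (paramsK24 Cmax CD) mbar nbar D).toExpansion
        ((famK (paramsK24 Cmax CD) mbar nbar D).single (memberK312 Cmax CD h)) α₀ δ₀ C := by
  obtain ⟨δ₀, hδ₀, H⟩ := prop21_freeLines (paramsK24 Cmax CD) mbar
  obtain ⟨C, hC, HC⟩ := H α₀ h0 h1 nbar
  exact ⟨δ₀, C, hδ₀, hC, fun D => HC D _ (posSubgraphsExcept24_memberK312 Cmax CD h D)⟩

end Members

end Literature.MathematicalPhysics.QuantumFieldTheory.Balaban1983to89.B3Eq312Member
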